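import Mathlib.Data.Real.Basic
import Mathlib.Data.Set.Finite.Lemmas
import Mathlib.Data.Finset.Max
import Mathlib.Tactic.Linarith
import Mathlib.Tactic.Ring
import HarnessLib

/-!
# [GenEll] Definition 1.2 (ii): the relations `≲`, `≳`, `≈` on functions and bounded discrepancy classes

S. Mochizuki, *Arithmetic elliptic curves in general position*, Math. J. Okayama Univ. 52 (2010)
1–28 [cite: MochizukiGenEll2010, Def 1.2 (ii) p.5] (kurims manuscript pagination, February 2009,
25 pp.), read on the page:

> **Definition 1.2.** (ii) Fix a subset `F ⊆ X(Q̄)`. If `α, β : F → ℝ` are functions, then we shall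
> write `α ≲_F β` (respectively, `α ≳_F β`; `α ≈_F β`) if there exists a ["constant"] `C ∈ ℝ`
> such that `β(x) − α(x) ≤ C` (respectively, `α(x) − β(x) ≤ C`; `|α(x) − β(x)| ≤ C`) for all
> `x ∈ F`; we shall omit the subscript `F` when there is no fear of confusion. [Thus, `α ≈ β` if
> and only if `α ≲ β` and `α ≳ β`.] The relation "`≈`" clearly defines an equivalence relation on
> the set of functions `F → ℝ`; we shall refer to an equivalence class relative to this equivalence
> relation as a(n) [`F`-]BD-class [i.e., "bounded discrepancy class"]. The BD-class of `α` will be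
> denoted by `[α]_F`, or simply `[α]`, when there is no fear of confusion. Finally, we observe that
> it makes sense to apply the notation "`≳`", "`≲`", "`≈`" to BD-classes.

with the **correction** printed in [IUTchIV] Remark 2.3.1 (ii) (kurims manuscript of April 2020,
p. 55) [claim: Mochizuki2012, status: disputed — the Remark itself is an erratum to [GenEll] and
is not part of the dispute]:

> (ii) In [GenEll], Definition 1.2, (ii), the non-resp'd and first resp'd items in the display
> should be reversed! That is to say, the notation "`α ≲_F β`" corresponds to "`α(x) − β(x) ≤ C`";
> the notation "`α ≳_F β`" corresponds to "`β(x) − α(x) ≤ C`".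

So, as used everywhere in [GenEll] §2 and [IUTchIV] §2 (e.g. "`ht ≲ (1+ε)(log-diff + log-cond)`
… i.e., the function `(1+ε)(log-diff + log-cond) − ht` is bounded below", [IUTchIV] Cor. 2.3
p. 54): `α ≲_F β` means `α − β` is bounded ABOVE on `F`.

## What is here

* `BDLe F α β` (`α ≲_F β`), `BDGe F α β` (`α ≳_F β`), `BDEquiv F α β` (`α ≈_F β`) for functions
  `α β : P → ℝ` on an ambient type `P` of points and a subset `F : Set P` (the paper's functions
  `F → ℝ` are modelled as functions on the ambient point set restricted to `F`; only values on `F`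
  matter);
* the bracketed sentence "`α ≈ β` iff `α ≲ β` and `α ≳ β`" (`bdEquiv_iff`), PROVED;
* "`≈` is an equivalence relation" (`BDEquiv.refl/symm/trans`, `bdSetoid`), PROVED; the BD-classes
  `BDClass F` as the quotient, with `[α]_F = BDClass.mk F α`;
* "it makes sense to apply `≲` to BD-classes": `BDClass.le`, well-defined (`BDClass.mk_le_mk`),
  a preorder — PROVED;
* the bookkeeping rules used in [GenEll] §2 / [IUTchIV] §2 without comment: `≲` is reflexive and
  transitive, monotone under shrinking `F`, compatible with `+`, with multiplication by a
  nonnegative constant, implied by a pointwise inequality, and insensitive to adding constants.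

Nothing here is specific to heights; the height, log-different and log-conductor functions of
[GenEll] Def. 1.5 live in `GenEllProjLine.lean`.
-/

namespace Literature.NumberTheory.DiophantineGeometry.GenEll

variable {P : Type*}

/-- `α ≲_F β` ([GenEll] Def. 1.2 (ii), as corrected by [IUTchIV] Rmk. 2.3.1 (ii)): there is a
constant `C ∈ ℝ` with `α(x) − β(x) ≤ C` for all `x ∈ F`, i.e. `α − β` is bounded above on `F`.
[cite: MochizukiGenEll2010, Def 1.2 (ii) p.5] -/
def BDLe (F : Set P) (α β : P → ℝ) : Prop :=
  ∃ C : ℝ, ∀ x ∈ F, α x - β x ≤ C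

/-- `α ≳_F β` ([GenEll] Def. 1.2 (ii), as corrected by [IUTchIV] Rmk. 2.3.1 (ii)): there is a
constant `C ∈ ℝ` with `β(x) − α(x) ≤ C` for all `x ∈ F`; by definition this is `β ≲_F α`.
[cite: MochizukiGenEll2010, Def 1.2 (ii) p.5] -/
def BDGe (F : Set P) (α β : P → ℝ) : Prop :=
  BDLe F β α

/-- `α ≈_F β` ([GenEll] Def. 1.2 (ii)): there is a constant `C ∈ ℝ` with `|α(x) − β(x)| ≤ C` for
all `x ∈ F` ("bounded discrepancy"). [cite: MochizukiGenEll2010, Def 1.2 (ii) p.5] -/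
def BDEquiv (F : Set P) (α β : P → ℝ) : Prop :=
  ∃ C : ℝ, ∀ x ∈ F, |α x - β x| ≤ C

variable {F F' : Set P} {α β γ δ : P → ℝ}

/-- Unfolding lemma for `≲`. [cite: MochizukiGenEll2010, Def 1.2 (ii) p.5] -/
theorem bdLe_iff : BDLe F α β ↔ ∃ C : ℝ, ∀ x ∈ F, α x - β x ≤ C := Iff.rfl

/-- Unfolding lemma for `≳`: `α ≳_F β ↔ β ≲_F α`. [cite: MochizukiGenEll2010, Def 1.2 (ii) p.5] -/
theorem bdGe_iff : BDGe F α β ↔ BDLe F β α := Iff.rfl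

/-- Unfolding lemma for `≈`. [cite: MochizukiGenEll2010, Def 1.2 (ii) p.5] -/
theorem bdEquiv_iff_abs : BDEquiv F α β ↔ ∃ C : ℝ, ∀ x ∈ F, |α x - β x| ≤ C := Iff.rfl

/-- The bracketed sentence of [GenEll] Def. 1.2 (ii): "`α ≈ β` if and only if `α ≲ β` and
`α ≳ β`". [cite: MochizukiGenEll2010, Def 1.2 (ii) p.5] -/
theorem bdEquiv_iff : BDEquiv F α β ↔ BDLe F α β ∧ BDGe F α β := by
  constructor
  · rintro ⟨C, hC⟩
    exact ⟨⟨C, fun x hx => (le_abs_self _).trans (hC x hx)⟩,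
      ⟨C, fun x hx => by have := hC x hx; rw [abs_sub_comm] at this; exact (le_abs_self _).trans this⟩⟩
  · rintro ⟨⟨C, hC⟩, ⟨C', hC'⟩⟩
    refine ⟨max C C', fun x hx => ?_⟩
    rw [abs_le]
    constructor
    · have := hC' x hx
      have : -(α x - β x) ≤ max C C' := by linarith [le_max_right C C']
      linarith
    · exact (hC x hx).trans (le_max_left _ _)

/-! ## `≲` is a preorder, monotone in `F`, compatible with the arithmetic used in [GenEll] §2 -/

/-- `≲` is reflexive. [cite: MochizukiGenEll2010, Def 1.2 (ii) p.5] -/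
theorem BDLe.refl (F : Set P) (α : P → ℝ) : BDLe F α α :=
  ⟨0, fun x _ => by simp⟩

/-- `≲` is transitive (chains of `≲` as in the displays of [GenEll] pp. 12–13).
[cite: MochizukiGenEll2010, Def 1.2 (ii) p.5] -/
theorem BDLe.trans (h₁ : BDLe F α β) (h₂ : BDLe F β γ) : BDLe F α γ := by
  obtain ⟨C₁, h₁⟩ := h₁
  obtain ⟨C₂, h₂⟩ := h₂
  exact ⟨C₁ + C₂, fun x hx => by linarith [h₁ x hx, h₂ x hx]⟩

/-- `≲` on `F` restricts to any subset `F' ⊆ F` (the "immediate from the definitions" direction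
(i) ⇒ (ii) of [GenEll] Thm. 2.1 is this remark). [cite: MochizukiGenEll2010, Def 1.2 (ii) p.5] -/
theorem BDLe.mono (h : BDLe F α β) (hF : F' ⊆ F) : BDLe F' α β := by
  obtain ⟨C, hC⟩ := h
  exact ⟨C, fun x hx => hC x (hF hx)⟩

/-- A pointwise inequality on `F` gives `≲` (with constant `0`).
[cite: MochizukiGenEll2010, Def 1.2 (ii) p.5] -/
theorem BDLe.of_le (h : ∀ x ∈ F, α x ≤ β x) : BDLe F α β :=
  ⟨0, fun x hx => by linarith [h x hx]⟩

/-- `≈` gives `≲`. [cite: MochizukiGenEll2010, Def 1.2 (ii) p.5] -/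
theorem BDEquiv.bdLe (h : BDEquiv F α β) : BDLe F α β := (bdEquiv_iff.mp h).1

/-- `≈` gives `≳`. [cite: MochizukiGenEll2010, Def 1.2 (ii) p.5] -/
theorem BDEquiv.bdGe (h : BDEquiv F α β) : BDGe F α β := (bdEquiv_iff.mp h).2

/-- `≲` is compatible with addition: `α ≲ β`, `γ ≲ δ` ⟹ `α + γ ≲ β + δ`.
[cite: MochizukiGenEll2010, Def 1.2 (ii) p.5] -/
theorem BDLe.add (h₁ : BDLe F α β) (h₂ : BDLe F γ δ) : BDLe F (α + γ) (β + δ) := by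
  obtain ⟨C₁, h₁⟩ := h₁
  obtain ⟨C₂, h₂⟩ := h₂
  refine ⟨C₁ + C₂, fun x hx => ?_⟩
  simp only [Pi.add_apply]
  linarith [h₁ x hx, h₂ x hx]

/-- `≲` is compatible with multiplication by a nonnegative constant (used with the factor `1 + ε`
in [GenEll] Thm. 2.1 / [IUTchIV] Cor. 2.3). [cite: MochizukiGenEll2010, Def 1.2 (ii) p.5] -/
theorem BDLe.const_mul {c : ℝ} (hc : 0 ≤ c) (h : BDLe F α β) :
    BDLe F (fun x => c * α x) (fun x => c * β x) := by
  obtain ⟨C, hC⟩ := h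
  refine ⟨c * C, fun x hx => ?_⟩
  have := mul_le_mul_of_nonneg_left (hC x hx) hc
  linarith [mul_sub c (α x) (β x)]

/-- Adding constants does not change `≲`: `α ≲ β ↔ α + a ≲ β + b`.
[cite: MochizukiGenEll2010, Def 1.2 (ii) p.5] -/
theorem bdLe_add_const_iff (a b : ℝ) :
    BDLe F (fun x => α x + a) (fun x => β x + b) ↔ BDLe F α β := by
  constructor
  · rintro ⟨C, hC⟩
    exact ⟨C + b - a, fun x hx => by have h := hC x hx; simp only at h; linarith⟩
  · rintro ⟨C, hC⟩
    exact ⟨C + a - b, fun x hx => by have h := hC x hx; simp only; linarith⟩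

/-- A function bounded above on `F` is `≲` any function bounded below on `F`; in particular two
bounded functions are `≈` (the "`≈ 0`" of [GenEll] p. 10). [cite: MochizukiGenEll2010, Def 1.2 (ii) p.5] -/
theorem BDLe.of_bddAbove_of_bddBelow {a b : ℝ} (hα : ∀ x ∈ F, α x ≤ a) (hβ : ∀ x ∈ F, b ≤ β x) :
    BDLe F α β :=
  ⟨a - b, fun x hx => by linarith [hα x hx, hβ x hx]⟩

/-- On the empty set every `≲` holds. [cite: MochizukiGenEll2010, Def 1.2 (ii) p.5] -/
theorem BDLe.of_empty (α β : P → ℝ) : BDLe (∅ : Set P) α β :=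
  ⟨0, fun _ hx => hx.elim⟩

/-- On a finite set every `≲` holds (finitely many exceptions never matter — cf. "[after possibly
eliminating finitely many elements from Ξ]" in the proof of [GenEll] Thm. 2.1, p. 12).
[cite: MochizukiGenEll2010, Def 1.2 (ii) p.5] -/
theorem BDLe.of_finite (hF : F.Finite) (α β : P → ℝ) : BDLe F α β := by
  classical
  obtain ⟨s, hs⟩ := hF.exists_finset_coe
  subst hs
  rcases s.eq_empty_or_nonempty with h | h
  · subst h
    exact ⟨0, fun x hx => by simp at hx⟩
  · obtain ⟨x₀, -, hx₀⟩ := s.exists_max_image (fun x => α x - β x) h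
    exact ⟨α x₀ - β x₀, fun x hx => hx₀ x (by simpa using hx)⟩

/-- `≲` on a union of two sets is `≲` on each. [cite: MochizukiGenEll2010, Def 1.2 (ii) p.5] -/
theorem bdLe_union_iff : BDLe (F ∪ F') α β ↔ BDLe F α β ∧ BDLe F' α β := by
  constructor
  · intro h
    exact ⟨h.mono Set.subset_union_left, h.mono Set.subset_union_right⟩
  · rintro ⟨⟨C, hC⟩, ⟨C', hC'⟩⟩
    refine ⟨max C C', fun x hx => ?_⟩
    rcases hx with hx | hx
    · exact (hC x hx).trans (le_max_left _ _)
    · exact (hC' x hx).trans (le_max_right _ _)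

/-- Removing a finite set of points does not change `≲`. [cite: MochizukiGenEll2010, Def 1.2 (ii) p.5] -/
theorem bdLe_diff_finite_iff {E : Set P} (hE : E.Finite) : BDLe (F \ E) α β ↔ BDLe F α β := by
  constructor
  · intro h
    have h' : BDLe (F \ E ∪ (F ∩ E)) α β :=
      bdLe_union_iff.mpr ⟨h, BDLe.of_finite (hE.subset Set.inter_subset_right) α β⟩
    exact h'.mono (fun x hx => by
      by_cases hxE : x ∈ E
      · exact Or.inr ⟨hx, hxE⟩
      · exact Or.inl ⟨hx, hxE⟩)
  · exact fun h => h.mono fun x hx => hx.1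

/-! ## `≈` is an equivalence relation; BD-classes -/

/-- `≈` is reflexive. [cite: MochizukiGenEll2010, Def 1.2 (ii) p.5] -/
theorem BDEquiv.refl (F : Set P) (α : P → ℝ) : BDEquiv F α α :=
  ⟨0, fun x _ => by simp⟩

/-- `≈` is symmetric. [cite: MochizukiGenEll2010, Def 1.2 (ii) p.5] -/
theorem BDEquiv.symm (h : BDEquiv F α β) : BDEquiv F β α := by
  obtain ⟨C, hC⟩ := h
  exact ⟨C, fun x hx => by rw [abs_sub_comm]; exact hC x hx⟩

/-- `≈` is transitive. [cite: MochizukiGenEll2010, Def 1.2 (ii) p.5] -/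
theorem BDEquiv.trans (h₁ : BDEquiv F α β) (h₂ : BDEquiv F β γ) : BDEquiv F α γ := by
  obtain ⟨C₁, h₁⟩ := h₁
  obtain ⟨C₂, h₂⟩ := h₂
  refine ⟨C₁ + C₂, fun x hx => ?_⟩
  calc |α x - γ x| = |(α x - β x) + (β x - γ x)| := by ring_nf
    _ ≤ |α x - β x| + |β x - γ x| := abs_add_le _ _
    _ ≤ C₁ + C₂ := add_le_add (h₁ x hx) (h₂ x hx)

/-- `≲` and `≳` together give `≈` (the other half of the bracketed sentence).
[cite: MochizukiGenEll2010, Def 1.2 (ii) p.5] -/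
theorem BDLe.antisymm (h₁ : BDLe F α β) (h₂ : BDLe F β α) : BDEquiv F α β :=
  bdEquiv_iff.mpr ⟨h₁, h₂⟩

/-- "The relation `≈` clearly defines an equivalence relation on the set of functions `F → ℝ`":
the setoid of `≈_F` on functions `P → ℝ`. [cite: MochizukiGenEll2010, Def 1.2 (ii) p.5] -/
def bdSetoid (F : Set P) : Setoid (P → ℝ) where
  r := BDEquiv F
  iseqv := ⟨BDEquiv.refl F, BDEquiv.symm, BDEquiv.trans⟩

/-- The set of `F`-BD-classes ("bounded discrepancy classes"): functions `P → ℝ` modulo `≈_F`.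
[cite: MochizukiGenEll2010, Def 1.2 (ii) p.5] -/
def BDClass (F : Set P) : Type _ := Quotient (bdSetoid F)

/-- The BD-class `[α]_F` of a function `α`. [cite: MochizukiGenEll2010, Def 1.2 (ii) p.5] -/
def BDClass.mk (F : Set P) (α : P → ℝ) : BDClass F := Quotient.mk (bdSetoid F) α

/-- `[α]_F = [β]_F ↔ α ≈_F β`. [cite: MochizukiGenEll2010, Def 1.2 (ii) p.5] -/
theorem BDClass.mk_eq_mk_iff : BDClass.mk F α = BDClass.mk F β ↔ BDEquiv F α β :=
  Quotient.eq (r := bdSetoid F)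

/-- Every BD-class is the class of some function. [cite: MochizukiGenEll2010, Def 1.2 (ii) p.5] -/
theorem BDClass.exists_rep (c : BDClass F) : ∃ α : P → ℝ, BDClass.mk F α = c :=
  Quotient.exists_rep c

/-- `≲` is invariant under `≈` on both sides — the content of "it makes sense to apply the notation
`≲` to BD-classes". [cite: MochizukiGenEll2010, Def 1.2 (ii) p.5] -/
theorem BDLe.congr (hα : BDEquiv F α γ) (hβ : BDEquiv F β δ) (h : BDLe F α β) : BDLe F γ δ :=
  (hα.bdGe.trans h).trans hβ.bdLe

/-- `≲` on BD-classes: `[α] ≲ [β] :↔ α ≲ β`, well defined by `BDLe.congr`.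
[cite: MochizukiGenEll2010, Def 1.2 (ii) p.5] -/
def BDClass.le (c d : BDClass F) : Prop :=
  Quotient.liftOn₂ (s₁ := bdSetoid F) (s₂ := bdSetoid F) c d (BDLe F)
    (fun _ _ _ _ h₁ h₂ => propext ⟨BDLe.congr h₁ h₂, BDLe.congr h₁.symm h₂.symm⟩)

/-- `≲` on BD-classes as the `≤` notation. [cite: MochizukiGenEll2010, Def 1.2 (ii) p.5] -/
instance : LE (BDClass F) := ⟨BDClass.le⟩

/-- `[α]_F ≤ [β]_F ↔ α ≲_F β`. [cite: MochizukiGenEll2010, Def 1.2 (ii) p.5] -/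
theorem BDClass.mk_le_mk : BDClass.mk F α ≤ BDClass.mk F β ↔ BDLe F α β := Iff.rfl

/-- BD-classes with `≲` form a partial order (antisymmetry is `bdEquiv_iff`).
[cite: MochizukiGenEll2010, Def 1.2 (ii) p.5] -/
instance : PartialOrder (BDClass F) where
  le := BDClass.le
  le_refl c := by
    obtain ⟨α, rfl⟩ := c.exists_rep
    exact BDLe.refl F α
  le_trans a b c hab hbc := by
    obtain ⟨α, rfl⟩ := a.exists_rep
    obtain ⟨β, rfl⟩ := b.exists_rep
    obtain ⟨γ, rfl⟩ := c.exists_rep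
    exact BDLe.trans hab hbc
  le_antisymm a b hab hba := by
    obtain ⟨α, rfl⟩ := a.exists_rep
    obtain ⟨β, rfl⟩ := b.exists_rep
    exact BDClass.mk_eq_mk_iff.mpr (BDLe.antisymm hab hba)

end Literature.NumberTheory.DiophantineGeometry.GenEll
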